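import Mathlib.LinearAlgebra.Matrix.SchurComplement
import Mathlib.LinearAlgebra.Matrix.NonsingularInverse
import Mathlib.Analysis.Complex.Basic
import HarnessLib

/-!
# K1-B meridian package, G2 part (g): block-diagonal transitivity — invertible matrices commuting with a diagonal
# matrix and moving a vector with prescribed block pattern to a reference vector
# (route `SignSymmetricPowers`, item stmt-HodgeConjecture-19716; helper for GEN / LINK-G)

Helper file (`--supports stmt-HodgeConjecture-19716`), pure linear algebra.  For the COVERAGE step of GEN the
singular ι-even forms are sorted by the TYPE of a singular point `z ≠ 0` (on `Π`, on `L`, or free), and each type is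
the orbit of a reference point under the group of invertible matrices commuting with `D = diagonal γ` (block-diagonal
for the eigenvalue pattern of `γ`).  This file proves that transitivity with rank-one corrections `1 − c rᵀ`
supported in one block (determinant `1 − r·c`, matrix determinant lemma):

* `det_one_sub_vecMulVec`, `one_sub_vecMulVec_mulVec`, `vecMulVec_commute_diagonal`;
* `exists_blockStep` — within the block `{l | g l = g i₀}`: if `v` and `w` are both non-zero on the block there is
  `N` commuting with `diagonal g`, with `IsUnit N.det`, and `N v = (w on the block, v off the block)`;
* `exists_commute_diagonal_mulVec_eq` (two blocks, the sign pattern `g = (a,a,b,b,b)`, `a ≠ b`): every `z` is moved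
  to the reference point of its type — `(0,0,*) ↦ e₄`, `(*,0,0,0) ↦ e₀`, free `↦ (1,0,1,0,0)`.

Sorry-free; axioms standard; no definition, no named fact.

## References

* [Hartshorne1977] R. Hartshorne, Algebraic Geometry, I Ex. 5.8 (context: moving singular points by `GL`).
-/

noncomputable section

set_option linter.dupNamespace false

open Matrix

namespace Summit.HodgeConjecture.HodgeConjecture.Theorems.SignSymmetricPowersGenBlockTransit

variable {k : Type*} [Fintype k] [DecidableEq k]

/-! ### §1 Rank-one corrections -/

/-- `det (1 − c rᵀ) = 1 − r · c` (matrix determinant lemma). [folklore] -/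
theorem det_one_sub_vecMulVec (c r : k → ℂ) : (1 - vecMulVec c r).det = 1 - r ⬝ᵥ c := by
  rw [sub_eq_add_neg, ← neg_vecMulVec, vecMulVec_eq (ι := Unit), det_one_add_replicateCol_mul_replicateRow,
    dotProduct_neg, sub_eq_add_neg]

/-- `(1 − c rᵀ) v = v − (r · v) c`. [folklore] -/
theorem one_sub_vecMulVec_mulVec (c r v : k → ℂ) : (1 - vecMulVec c r) *ᵥ v = v - (r ⬝ᵥ v) • c := by
  rw [sub_mulVec, one_mulVec, vecMulVec_mulVec]
  congr 1
  funext l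
  simp [Pi.smul_apply, MulOpposite.smul_eq_mul_unop, mul_comm]

/-- A rank-one matrix `c rᵀ` supported in one block of `g` commutes with `diagonal g`. [folklore] -/
theorem vecMulVec_commute_diagonal (g c r : k → ℂ) (h : ∀ i j, c i ≠ 0 → r j ≠ 0 → g i = g j) :
    vecMulVec c r * diagonal g = diagonal g * vecMulVec c r := by
  ext i j
  rw [mul_diagonal, diagonal_mul, vecMulVec_apply]
  by_cases hc : c i = 0
  · simp [hc]
  by_cases hr : r j = 0
  · simp [hr]
  rw [h i j hc hr]; ring

/-- Hence `1 − c rᵀ` commutes with `diagonal g`. [folklore] -/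
theorem one_sub_vecMulVec_commute_diagonal (g c r : k → ℂ) (h : ∀ i j, c i ≠ 0 → r j ≠ 0 → g i = g j) :
    (1 - vecMulVec c r) * diagonal g = diagonal g * (1 - vecMulVec c r) := by
  rw [Matrix.sub_mul, Matrix.mul_sub, Matrix.one_mul, Matrix.mul_one, vecMulVec_commute_diagonal g c r h]

omit [DecidableEq k] in
/-- Products of matrices commuting with `D` commute with `D`. [folklore] -/
theorem mul_commute {A B D : Matrix k k ℂ} (hA : A * D = D * A) (hB : B * D = D * B) :
    A * B * D = D * (A * B) := by
  rw [Matrix.mul_assoc, hB, ← Matrix.mul_assoc, hA, Matrix.mul_assoc]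

/-- **One rank-one step**: if `v i ≠ 0` and `t i ≠ 0`, and `v − t` is supported in the block of `i`, then
`N = 1 − (v − t)((v i)⁻¹ e_i)ᵀ` commutes with `diagonal g`, is invertible, and `N v = t`. [folklore] -/
theorem exists_step (g v t : k → ℂ) (i : k) (hvi : v i ≠ 0) (hti : t i ≠ 0)
    (hsupp : ∀ l, g l ≠ g i → v l = t l) :
    ∃ N : Matrix k k ℂ, N * diagonal g = diagonal g * N ∧ IsUnit N.det ∧ N *ᵥ v = t := by
  refine ⟨1 - vecMulVec (v - t) ((v i)⁻¹ • Pi.single i 1), ?_, ?_, ?_⟩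
  · refine one_sub_vecMulVec_commute_diagonal g _ _ fun l j hl hj => ?_
    have hj' : j = i := by
      by_contra hne
      apply hj; simp [hne]
    subst hj'
    by_contra hne
    exact hl (by rw [Pi.sub_apply, hsupp l hne, sub_self])
  · rw [det_one_sub_vecMulVec, isUnit_iff_ne_zero]
    have : ((v i)⁻¹ • Pi.single i (1 : ℂ)) ⬝ᵥ (v - t) = 1 - (v i)⁻¹ * t i := by
      rw [smul_dotProduct, single_dotProduct, one_mul, Pi.sub_apply, smul_eq_mul, mul_sub, inv_mul_cancel₀ hvi]
    rw [this, sub_sub_cancel]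
    exact mul_ne_zero (inv_ne_zero hvi) hti
  · rw [one_sub_vecMulVec_mulVec]
    have : ((v i)⁻¹ • Pi.single i (1 : ℂ)) ⬝ᵥ v = 1 := by
      rw [smul_dotProduct, single_dotProduct, one_mul, smul_eq_mul, inv_mul_cancel₀ hvi]
    rw [this, one_smul, sub_sub_cancel]

/-! ### §2 Transitivity inside one block -/

/-- **Block step**: if `v` and `w` are both non-zero somewhere on the block `{l | g l = g i₀}`, there is an invertible
`N` commuting with `diagonal g` with `N v = w` on the block and `= v` off the block. [folklore] -/
theorem exists_blockStep (g : k → ℂ) (i₀ : k) (v w : k → ℂ) (hv : ∃ i, g i = g i₀ ∧ v i ≠ 0)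
    (hw : ∃ j, g j = g i₀ ∧ w j ≠ 0) :
    ∃ N : Matrix k k ℂ, N * diagonal g = diagonal g * N ∧ IsUnit N.det ∧
      N *ᵥ v = fun l => if g l = g i₀ then w l else v l := by
  classical
  set t : k → ℂ := fun l => if g l = g i₀ then w l else v l with ht
  by_cases hA : ∃ i, g i = g i₀ ∧ v i ≠ 0 ∧ w i ≠ 0
  · obtain ⟨i, hgi, hvi, hwi⟩ := hA
    have hti : t i ≠ 0 := by rw [ht]; simp only [hgi, if_true]; exact hwi
    obtain ⟨N, hN, hdet, hNv⟩ := exists_step g v t i hvi hti (fun l hl => by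
      rw [ht]; simp only; rw [if_neg (fun h => hl (h.trans hgi.symm))])
    exact ⟨N, hN, hdet, hNv⟩
  · push Not at hA
    obtain ⟨i, hgi, hvi⟩ := hv
    obtain ⟨j, hgj, hwj⟩ := hw
    have hwi : w i = 0 := hA i hgi hvi
    have hvj : v j = 0 := by by_contra h; exact hwj (hA j hgj h)
    -- intermediate target `t' = v + w` on the block
    set t' : k → ℂ := fun l => if g l = g i₀ then v l + w l else v l with ht'
    have ht'i : t' i ≠ 0 := by rw [ht']; simp only [hgi, if_true, hwi, add_zero]; exact hvi
    obtain ⟨N₁, hN₁, hdet₁, hN₁v⟩ := exists_step g v t' i hvi ht'i (fun l hl => by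
      rw [ht']; simp only; rw [if_neg (fun h => hl (h.trans hgi.symm))])
    have ht'j : t' j ≠ 0 := by rw [ht']; simp only [hgj, if_true, hvj, zero_add]; exact hwj
    have htj : t j ≠ 0 := by rw [ht]; simp only [hgj, if_true]; exact hwj
    obtain ⟨N₂, hN₂, hdet₂, hN₂v⟩ := exists_step g t' t j ht'j htj (fun l hl => by
      rw [ht', ht]; simp only
      rw [if_neg (fun h => hl (h.trans hgj.symm)), if_neg (fun h => hl (h.trans hgj.symm))])
    refine ⟨N₂ * N₁, mul_commute hN₂ hN₁, by rw [det_mul]; exact hdet₂.mul hdet₁, ?_⟩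
    rw [← mulVec_mulVec, hN₁v, hN₂v]

/-! ### §3 The sign pattern: two blocks `{0,1}` and `{2,3,4}` -/

/-- The eigenvalue pattern of the sign involution, as a `ℂ`-valued vector: `(−1,−1,1,1,1)`. Two indices are in the
same block iff they are both `< 2` or both `≥ 2`. [folklore] -/
theorem sign_eq_iff (i j : Fin 5) :
    ((fun l : Fin 5 => if (l : ℕ) < 2 then (-1 : ℂ) else 1) i = (fun l : Fin 5 => if (l : ℕ) < 2 then (-1 : ℂ) else 1) j)
      ↔ (((i : ℕ) < 2) ↔ ((j : ℕ) < 2)) := by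
  simp only
  split_ifs with hi hj hj <;> simp [hi, hj] <;> norm_num

/-- **Free type**: `z` non-zero on both blocks is moved to `q = (1,0,1,0,0)` by an invertible matrix commuting with
`diagonal (−1,−1,1,1,1)`. [folklore] -/
theorem exists_commute_mulVec_eq_free (z : Fin 5 → ℂ) (h01 : z 0 ≠ 0 ∨ z 1 ≠ 0)
    (h234 : z 2 ≠ 0 ∨ z 3 ≠ 0 ∨ z 4 ≠ 0) :
    ∃ N : Matrix (Fin 5) (Fin 5) ℂ,
      N * diagonal (fun l : Fin 5 => if (l : ℕ) < 2 then (-1 : ℂ) else 1) =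
        diagonal (fun l : Fin 5 => if (l : ℕ) < 2 then (-1 : ℂ) else 1) * N ∧
      IsUnit N.det ∧ N *ᵥ z = ![1, 0, 1, 0, 0] := by
  set g : Fin 5 → ℂ := fun l : Fin 5 => if (l : ℕ) < 2 then (-1 : ℂ) else 1 with hg
  -- block of `0`
  obtain ⟨N₁, hN₁, hdet₁, hN₁z⟩ := exists_blockStep g 0 z ![1, 0, 1, 0, 0]
    (by rcases h01 with h | h
        · exact ⟨0, rfl, h⟩
        · exact ⟨1, by simp [hg], h⟩)
    ⟨0, rfl, by simp⟩
  -- block of `2`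
  obtain ⟨N₂, hN₂, hdet₂, hN₂z⟩ := exists_blockStep g 2 (N₁ *ᵥ z) ![1, 0, 1, 0, 0]
    (by rw [hN₁z]
        rcases h234 with h | h | h
        · exact ⟨2, rfl, by simp [hg]; norm_num; exact h⟩
        · exact ⟨3, by simp [hg], by simp [hg]; norm_num; exact h⟩
        · exact ⟨4, by simp [hg], by simp [hg]; norm_num; exact h⟩)
    ⟨2, rfl, by simp⟩
  refine ⟨N₂ * N₁, mul_commute hN₂ hN₁, by rw [det_mul]; exact hdet₂.mul hdet₁, ?_⟩
  rw [← mulVec_mulVec, hN₂z, hN₁z]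
  funext l
  fin_cases l <;> simp [hg]

/-- **Π type**: `z = (0,0,*)`, non-zero, is moved to `e₄ = (0,0,0,0,1)`. [folklore] -/
theorem exists_commute_mulVec_eq_pi (z : Fin 5 → ℂ) (h0 : z 0 = 0) (h1 : z 1 = 0)
    (h234 : z 2 ≠ 0 ∨ z 3 ≠ 0 ∨ z 4 ≠ 0) :
    ∃ N : Matrix (Fin 5) (Fin 5) ℂ,
      N * diagonal (fun l : Fin 5 => if (l : ℕ) < 2 then (-1 : ℂ) else 1) =
        diagonal (fun l : Fin 5 => if (l : ℕ) < 2 then (-1 : ℂ) else 1) * N ∧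
      IsUnit N.det ∧ N *ᵥ z = ![0, 0, 0, 0, 1] := by
  set g : Fin 5 → ℂ := fun l : Fin 5 => if (l : ℕ) < 2 then (-1 : ℂ) else 1 with hg
  obtain ⟨N, hN, hdet, hNz⟩ := exists_blockStep g 2 z ![0, 0, 0, 0, 1]
    (by rcases h234 with h | h | h
        · exact ⟨2, rfl, h⟩
        · exact ⟨3, by simp [hg], h⟩
        · exact ⟨4, by simp [hg], h⟩)
    ⟨4, by simp [hg], by simp⟩
  refine ⟨N, hN, hdet, ?_⟩
  rw [hNz]
  funext l
  fin_cases l <;> simp [hg, h0, h1]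

/-- **L type**: `z = (*,*,0,0,0)`, non-zero, is moved to `e₀ = (1,0,0,0,0)`. [folklore] -/
theorem exists_commute_mulVec_eq_line (z : Fin 5 → ℂ) (h01 : z 0 ≠ 0 ∨ z 1 ≠ 0) (h2 : z 2 = 0) (h3 : z 3 = 0)
    (h4 : z 4 = 0) :
    ∃ N : Matrix (Fin 5) (Fin 5) ℂ,
      N * diagonal (fun l : Fin 5 => if (l : ℕ) < 2 then (-1 : ℂ) else 1) =
        diagonal (fun l : Fin 5 => if (l : ℕ) < 2 then (-1 : ℂ) else 1) * N ∧
      IsUnit N.det ∧ N *ᵥ z = ![1, 0, 0, 0, 0] := by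
  set g : Fin 5 → ℂ := fun l : Fin 5 => if (l : ℕ) < 2 then (-1 : ℂ) else 1 with hg
  obtain ⟨N, hN, hdet, hNz⟩ := exists_blockStep g 0 z ![1, 0, 0, 0, 0]
    (by rcases h01 with h | h
        · exact ⟨0, rfl, h⟩
        · exact ⟨1, by simp [hg], h⟩)
    ⟨0, rfl, by simp⟩
  refine ⟨N, hN, hdet, ?_⟩
  rw [hNz]
  funext l
  fin_cases l <;> simp [hg, h2, h3, h4]

end Summit.HodgeConjecture.HodgeConjecture.Theorems.SignSymmetricPowersGenBlockTransit

end
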